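import Summits.CriticalPhenomena.PercolationContinuityZ3.Theorems.PercNearOneGluingNoHeavyLowerTailMixCSHUnfoldMain
import Summits.CriticalPhenomena.PercolationContinuityZ3.Theorems.PercNearOneGluingNoHeavyLowerTailMixCSHHtwBridge
import Summits.CriticalPhenomena.PercolationContinuityZ3.Theorems.PercNearOneGluingNoHeavyLowerTailMixCSHInduction
import HarnessLib

/-!
# `NoHeavyLowerTail` (stmt-CriticalPhenomena-4575) — MIXED conditioned slack hierarchy (hub observer): the world-wise mixed margin is nonnegative
# given the lower MIXED levels and the remainders (Lemma U-mix + Lemma H-mix)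

Support file (`--supports stmt-CriticalPhenomena-4575`), prover `prim-hp-7` (gen 33); part (e) of brick B2 (`MixCSHUnfold`) of prim-ineq-gen-7's Lean blueprint for
THEOREM M1 (memo `prim-ineq-gen-7/PROOF-Q9-MIXED-CSH.md` §3.5 / §10).  No definitions, no named facts, no sorries.

`MixCSH.mix_within_nonneg` — `MixCSH.mix_within_nonneg_of_hpart` (`…MixCSHUnfoldMain.lean`, this seat) with its H-part hypothesis DISCHARGED by
prim-ineq-gen-7's Lemma H-mix `MixCSH.hpart_nonneg_hub` (`…MixCSHHtwBridge.lean`, brick B4): for weights `< 1` (the hierarchy runs on `H = G − E(o)`), `o ≠ v`,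
`v ∉ {x} ∪ Y`, distinct decoys off `x, Y, o, v`, `g` monotone `≥ 0`, the world-wise mixed margin `∫_{x↮Y} Marg[W^ω_g] dμ_w` — verbatim the hypothesis `hW` of the
mixed Lemma T `MixCSH.mixCshMargin_nonneg_of_within` (brick B1) and the conclusion of the hypothesis `hU` of prim-ineq-gen-7's induction skeleton
`MixCSH.mixCSHHolds_of_unfold` (`…MixCSHInduction.lean`) — is nonnegative as soon as the lower-level MIXED margins are (`hIH`, the induction hypothesis) and every
remainder `MixCSH.hubRem` of the hub row is `≤ 0` (`hR`: Lemma R⁻ = brick B3, prim-ineq-gen-7's `MixCSH.hubRem_nonpos` of `…MixCSHRemainder.lean`).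
So THEOREM M1 = the induction skeleton over B1 + this file + `MixCSH.hubRem_nonpos` (prim-ineq-gen-7's `…MixCSHTheoremOne.lean`).
(This file and `…MixCSHUnfoldMain.lean` live in different import contexts, which synthesise different `Decidable` instances inside the world weights; `convert … using 40`
bridges them — a smaller depth stops above the `ite`s and then times out in `whnf`.  `…MixCSHInduction.lean` is imported only so that this statement is elaborated
in the instance context of its consumer `MixCSH.mixCSHHolds_of_unfold`.)
[cite: VandenbergHaggstromKahn2005, §2.1 (pp. 9–13), Thm. 2.1 (p. 9)] [cite: KozmaNitzan2024, Question 9 (§5.5 p. 36), Conj. 4 (p. 32)]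
-/

noncomputable section

namespace Summit.CriticalPhenomena.PercolationContinuityZ3.Theorems

open MeasureTheory Set Literature.Probability.LatticeModels Literature.Probability.Percolation
open scoped Classical
open BHK2006 DecisionTree HullPort CSH

namespace MixCSH

variable {V : Type*} [Fintype V]

/-- **The world-wise MIXED margin is nonnegative given the lower MIXED levels and the remainders** — `mix_within_nonneg_of_hpart` with the mixed H-part
DISCHARGED by prim-ineq-gen-7's Lemma H-mix `MixCSH.hpart_nonneg_hub` (brick B4): the hypothesis `hW` of the mixed Lemma T `MixCSH.mixCshMargin_nonneg_of_within`
modulo the induction hypothesis (lower MIXED margins) and Lemma R⁻ (brick B3, hypothesis `hR`).  Data: weights `< 1`, `x ∉ Y`, `o ≠ v`, `v ∉ {x} ∪ Y`,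
decoys distinct and off `x, Y, o, v`, `g` monotone `≥ 0`.
(transcription of the cell memo prim-ineq-gen-7 PROOF-Q9-MIXED-CSH.md §3.5, proof of Theorem M1, inductive step) [cite: KozmaNitzan2024, Question 9 (§5.5 p. 36)] -/
theorem mix_within_nonneg (w : Sym2 V → unitInterval) (hw : ∀ e, w e < 1) (Sig : Set V) (x : V) (Y : Set V)
    (D : List V) (o v : V) (hov : o ≠ v) (hv : v ∉ insert x Y) (hnd : D.Nodup) (hD : ∀ d ∈ D, d ≠ x ∧ d ∉ Y ∧ d ≠ o ∧ d ≠ v)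
    {g : Set (Sym2 V) → ℝ} (hg : Monotone g) (hg0 : ∀ C, 0 ≤ g C)
    (hIH : ∀ (pre : List V) (d : V) (ds' : List V), D = pre ++ d :: ds' →
      ∀ h : Set (Sym2 V) → ℝ, Monotone h → (∀ C, 0 ≤ h C) →
        0 ≤ mixCshMargin w Sig d (insert x Y ∪ {e | e ∈ pre}) ds' o v h)
    (hR : ∀ (S : Set V) (d : V), x ∈ S → d ∉ S → d ∉ Y → hubRem (fun e => (w e : ℝ)) x Y g Sig d (S ∪ Y) ≤ 0) :
    0 ≤ ∫ ω in {ω : BondConfig V | ∀ y ∈ Y, ¬ (openGraph ω).Reachable x y},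
        cshMarg (mixDecoyList w Sig o (insert x Y) D) (mixObsConst w Sig v (insert x Y ∪ {d | d ∈ D})) o v
          (fun u => if u = o then
              (if (∀ z ∈ Sig, ∀ y ∈ Y, ¬ (openGraph ω).Reachable y z) then (1 : ℝ) else 0) *
                ((∫ η in {η : BondConfig V | ∃ z ∈ Sig, (openGraph η).Reachable x z}, g (openEdgeCluster η x)
                    ∂(prodBernoulli fun e => if (∃ z ∈ e, ∃ y ∈ Y, (openGraph ω).Reachable y z)
                      then (0 : unitInterval) else w e)) -
                  (∫ η, g (openEdgeCluster η x)
                    ∂(prodBernoulli fun e => if (∃ z ∈ e, ∃ y ∈ Y, (openGraph ω).Reachable y z)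
                      then (0 : unitInterval) else w e)) *
                  (prodBernoulli fun e => if (∃ z ∈ e, ∃ y ∈ Y, (openGraph ω).Reachable y z)
                      then (0 : unitInterval) else w e).real
                    {η : BondConfig V | ∃ z ∈ Sig, (openGraph η).Reachable x z})
            else
              (∫ η in (openConn x u : Set (BondConfig V)), g (openEdgeCluster η x)
                  ∂(prodBernoulli fun e => if (∃ z ∈ e, ∃ y ∈ Y, (openGraph ω).Reachable y z)
                    then (0 : unitInterval) else w e)) -
                (∫ η, g (openEdgeCluster η x)
                  ∂(prodBernoulli fun e => if (∃ z ∈ e, ∃ y ∈ Y, (openGraph ω).Reachable y z)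
                    then (0 : unitInterval) else w e)) *
                (prodBernoulli fun e => if (∃ z ∈ e, ∃ y ∈ Y, (openGraph ω).Reachable y z)
                    then (0 : unitInterval) else w e).real (openConn x u : Set (BondConfig V)))
        ∂(prodBernoulli w) := by
  have hv' : v ≠ x ∧ v ∉ Y := by rwa [Set.mem_insert_iff, not_or] at hv
  have hvS : v ∉ insert x D.toFinset := by
    rw [Finset.mem_insert, List.mem_toFinset, not_or]
    exact ⟨hv'.1, fun h => (hD v h).2.2.2 rfl⟩
  have hS : ((↑(insert x D.toFinset) : Set V) ∪ Y) = insert x Y ∪ {d | d ∈ D} := by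
    ext u
    simp only [Finset.coe_insert, Set.mem_union, Set.mem_insert_iff, Finset.mem_coe, List.mem_toFinset, Set.mem_setOf_eq]
    tauto
  have key := hpart_nonneg_hub w hw x Y (insert x D.toFinset) (Finset.mem_insert_self x _) Sig v hvS hv'.2 g hg hg0
  rw [hS] at key
  -- the statements agree up to the (subsingleton) decidability instances inside the indicators / world weights (different import contexts)
  have main := mix_within_nonneg_of_hpart w hw Sig x Y D o v hov hnd hD hg hIH hR (by
    convert key using 40)
  convert main using 40

end MixCSH

end Summit.CriticalPhenomena.PercolationContinuityZ3.Theorems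

end
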